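import Summits.QuantumFields.YangMills.Theorems.AllWindowsColdBoxBoxHighLineK3PrimeRowE1Wilson
import Summits.QuantumFields.YangMills.Theorems.AllWindowsColdBoxBoxHighLineWilsonPlaquetteQuarticForm

/-!
# U5 K3′ — the quartic Wilson vertex OF RECORD, packaged for the hK3 row-sum instantiation: ONE existential `hW4_of_record`
# (planner ym-idea-2 g19 «(a) YOURS» 2026-08-30T02:19:30Z; consumed by `GaussRestrict.rowBound_RA` (✓`…K3PrimeRowRA`) and by w3 g42's `K3RowSum.rowBound_E1_wilson`;
# LINE-20 U5 ⟨stmt-QuantumFields-24336⟩ — U5 prep, helper-grade)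

Extra width seat `ym-line-sfw-p2-w4` (g30).  The hK3 row-sum ✓`tiltCum3_cutSet_size_of_rows (Vr) …` is instantiated at the vertex of record
`Vr β H a := −W4 β H a − β·phiQuartic H a`, where `W4 β H a := β·Σ_{p ∈ PT} Σ_{ijkl} Q i j k l·((v^p_i·v^p_j)(v^p_k·v^p_l))` is the polynomial quartic part of
`quarticWilson` for the tensor `Q` of w3 g42's ✓`WilsonTaylor.exists_quarticTensor_quarticWilson` (7a⁽⁴⁾).  Both `hE1r` (exact Wick row, w3's `rowBound_E1_wilson`)
and `hRA` (✓`GaussRestrict.rowBound_RA (W4) (mW4) (CR) (hCR) (hW4)`) must be fed THE SAME `Q`, so the record is ONE existential: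

* ★ `K3RowSum.hW4_of_record` — `∃ Q, (∀ i j k l, |Q i j k l| ≤ 1/2) ∧ (∀ β H, Measurable (W4 β H)) ∧
  ∀ H ≥ 1, ∀ β > 0, ∀ s ∈ [0,1], ∀ a ∈ smallField H s, |quarticWilson β H a − W4 β H a| ≤ 81920·β·H⁴·s⁶`
  (`W4` spelled out as the explicit lambda; measurability by w3's ✓`EdgeChartGaussian.polyCert_quarticPairVertex` + ✓`measurable_of_polyCert`; the sup bound is
  clause 3 of ✓`exists_quarticTensor_quarticWilson` with `|β| = β`).

Usage: `obtain ⟨Q, hQ, mW4, hW4⟩ := K3RowSum.hW4_of_record`; then `GaussRestrict.rowBound_RA (fun β H a => β * Σ …Q…) mW4 81920 (by norm_num) hW4` is `hRA`, and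
`K3RowSum.rowBound_E1_wilson θ hθ hθ' (1/2) Q hQ` is the Wilson half of `hE1r`.

No definitions; tree only; standard axioms.  HONEST LABEL: helper-grade packaging for the UNSTAFFED stub U5; `hK3`, U5, ⟨24336⟩, ⟨24004⟩ and this seat's crux
⟨stmt-QuantumFields-22884⟩ remain OPEN; route AllWindowsColdBox is DRAFT; no crux, rung or summit is proved; **the Yang–Mills mass gap is NOT proved by this file; no
summit is proved by a line.**
-/

set_option autoImplicit false

noncomputable section

open MeasureTheory Matrix Finset
open Literature.Probability.LatticeModels (Site)
open Literature.MathematicalPhysics.QuantumLattice (ZdPlaquette plaquettesTouching)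
open Literature.MathematicalPhysics.QuantumFieldTheory.AxialGauge (boxEdges)

namespace Summit.QuantumFields.YangMills.Theorems.AllWindowsColdBoxBoxHighLine

namespace K3RowSum

/-- ★ **The quartic Wilson vertex of record** (one existential for the whole hK3 instantiation): a pair tensor `Q` with `|Q| ≤ 1/2`, the measurable polynomial
vertex `W4 β H a = β·Σ_p Σ_{ijkl} Q i j k l·((v^p_i·v^p_j)(v^p_k·v^p_l))`, and the sextic sup remainder `|quarticWilson − W4| ≤ 81920·β·H⁴·s⁶` on `smallField H s`
(`H ≥ 1`, `β > 0`, `0 ≤ s ≤ 1`). -/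
theorem hW4_of_record : ∃ Q : Fin 4 → Fin 4 → Fin 4 → Fin 4 → ℝ, (∀ i j k l, |Q i j k l| ≤ 1 / 2) ∧
    (∀ (β : ℝ) (H : ℕ), Measurable fun a : LandauFree H → E3 =>
      β * ∑ p ∈ plaquettesTouching (boxEdges 4 (2 * H + 1)), ∑ i : Fin 4, ∑ j : Fin 4, ∑ k : Fin 4, ∑ l : Fin 4, Q i j k l *
        ((WithLp.ofLp (plaqVar H p.1 p.2.1.1 p.2.1.2 a i) ⬝ᵥ WithLp.ofLp (plaqVar H p.1 p.2.1.1 p.2.1.2 a j)) *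
          (WithLp.ofLp (plaqVar H p.1 p.2.1.1 p.2.1.2 a k) ⬝ᵥ WithLp.ofLp (plaqVar H p.1 p.2.1.1 p.2.1.2 a l)))) ∧
    ∀ H : ℕ, 1 ≤ H → ∀ β : ℝ, 0 < β → ∀ s : ℝ, 0 ≤ s → s ≤ 1 → ∀ a ∈ smallField H s,
      |quarticWilson β H a - β * ∑ p ∈ plaquettesTouching (boxEdges 4 (2 * H + 1)), ∑ i : Fin 4, ∑ j : Fin 4, ∑ k : Fin 4, ∑ l : Fin 4, Q i j k l *
        ((WithLp.ofLp (plaqVar H p.1 p.2.1.1 p.2.1.2 a i) ⬝ᵥ WithLp.ofLp (plaqVar H p.1 p.2.1.1 p.2.1.2 a j)) *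
          (WithLp.ofLp (plaqVar H p.1 p.2.1.1 p.2.1.2 a k) ⬝ᵥ WithLp.ofLp (plaqVar H p.1 p.2.1.1 p.2.1.2 a l)))| ≤
        81920 * β * (H : ℝ) ^ 4 * s ^ 6 := by
  obtain ⟨Q, hQ, -, hW⟩ := WilsonTaylor.exists_quarticTensor_quarticWilson
  refine ⟨Q, hQ, fun β H => EdgeChartGaussian.measurable_of_polyCert (EdgeChartGaussian.polyCert_quarticPairVertex β Q hQ), fun H hH β hβ s hs0 hs1 a ha => ?_⟩
  have h := hW H hH β s hs0 hs1 a ha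
  rwa [abs_of_pos hβ] at h

end K3RowSum

end Summit.QuantumFields.YangMills.Theorems.AllWindowsColdBoxBoxHighLine
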